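import Summits.MatrixMultiplication.MatrixMultiplication.Theorems.FarEdgeDescentSignTwistDet
import HarnessLib

/-!
# Determinant classes of the generic twists: `𝔖^♭, 𝔖^♭ᵀ ⋭ 𝔖^ᵀ` and `𝔖^ᵀ ⋭ 𝔖^♭, 𝔖^♭ᵀ`

Route `FarEdgeDescent` (cell `decomp-mm`, lens 2 «structural dichotomy (special vs generic)»,
gen 32), Kernel VII continued; support for the aside `SubLogRate` (stmt-MatrixMultiplication-25371).

`FarEdgeDescentSignTwistDet` attached to a degeneration `ε^h t + O(ε^{h+1}) = (A ⊗ B ⊗ C)·s`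
(first and third slots of equal format) the SLICE IDENTITY `ε^{h·n} D = φ(q) · det S(y(x))`,
`D(0) = det T(x)`, and read off `𝔖^♭, 𝔖^♭ᵀ ⋭ ⟨2,2,2⟩` from `det S = det Y · perm Y` versus
`det T = (det X)²`. Here the same identity sorts the three GENERIC twist classes of `n = 2`
(`ᵀ`, `♭`, `♭ᵀ`) among each other by their determinant classes

* `𝔖^ᵀ`: `det S(y) = det T(x)|_{x ↦ y} = (det Y)²` (`det_Smat_twistedStar`, `det_Tmat_twistedStar`);
* `𝔖^♭, 𝔖^♭ᵀ`: `det Y · perm Y` (`det_Tmat_signStar`, `det_Tmat_signTStar`);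

giving, in characteristic `≠ 2` and for a single copy,
* `𝔖^♭ ⋭ 𝔖^ᵀ`, `𝔖^♭ᵀ ⋭ 𝔖^ᵀ` (`signStar_not_algDegeneratesTo_twistedStar`, …): target class
  `det²` — the argument of the `⟨2,2,2⟩` case verbatim (`not_algDegeneratesTo_of_det_slice`);
* `𝔖^ᵀ ⋭ 𝔖^♭`, `𝔖^ᵀ ⋭ 𝔖^♭ᵀ` (`twistedStar_not_algDegeneratesTo_signStar`, …): trailing
  coefficients give `det X · perm X = c · u²` with `u` a quadratic form, so `det X ∣ u`
  (`det X` is prime), `u = κ det X`, `perm X = c κ² det X` — impossible (`permX_ne_C_mul_detX`).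

Together with `FarEdgeDescentSignTwistDet` (`♭, ♭ᵀ` versus `⟨2,2,2⟩`), `FarEdgeDescentTwistImage`
(`ᵀ` versus `⟨2,2,2⟩`, image class) and `FarEdgeDescentTwistRigidity`: the coherent star and the
generic classes `ᵀ, ♭, ♭ᵀ` are pairwise degeneration-incomparable at `N = 1`, except for the pair
`(♭, ♭ᵀ)` of equal determinant class (`generic_twists_detClass_incomparable`).

References: P. Bürgisser, M. Clausen, M. A. Shokrollahi, *Algebraic Complexity Theory* (1997),
(15.19), §20.2 [BurgisserClausenShokrollahi1997]; H. Cohn, C. Umans, *Fast matrix multiplication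
using coherent configurations*, SODA 2013, §3 [CohnUmans2013]; V. Strassen, J. reine angew.
Math. 375/376 (1987), §4 [Strassen1987].
-/

noncomputable section

open scoped BigOperators Polynomial Matrix

set_option linter.dupNamespace false

namespace Summit.MatrixMultiplication.MatrixMultiplication.Theorems.FarEdgeDescentSignTwistDet

open Literature.Computability.AlgebraicComplexity
open Summit.MatrixMultiplication.MatrixMultiplication.Theorems.FarEdgeDescentSignTwist
open Summit.MatrixMultiplication.MatrixMultiplication.Theorems.FarEdgeDescentTwistedStar
open Summit.MatrixMultiplication.MatrixMultiplication.Theorems.FarEdgeDescentTwistRigidity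

universe u

/-! ## The permanent -/

section Perm
variable (K : Type u) [Field K]

/-- The generic `2 × 2` permanent `x₀₀x₁₁ + x₀₁x₁₀`. [folklore] -/
def permX : Rx K :=
  MvPolynomial.X (0, 0) * MvPolynomial.X (1, 1) + MvPolynomial.X (0, 1) * MvPolynomial.X (1, 0)

/-- `perm X ≠ 0` (value `1` at `X = 1₂`). [folklore] -/
theorem permX_ne_zero : permX K ≠ 0 := by
  intro h
  have h1 := congrArg (MvPolynomial.eval fun b : Fin 2 × Fin 2 => if b.1 = b.2 then (1 : K) else 0) h
  simp [permX] at h1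

variable {K} in
/-- **`perm X` is not a multiple of `det X`** in characteristic `≠ 2` (values at `1₂` and at the
transposition matrix). [folklore] -/
theorem permX_ne_C_mul_detX (h2 : (2 : K) ≠ 0) (w : K) : permX K ≠ MvPolynomial.C w * detX K := by
  intro h
  have h1 := congrArg (MvPolynomial.eval fun b : Fin 2 × Fin 2 => if b.1 = b.2 then (1 : K) else 0) h
  have h3 := congrArg (MvPolynomial.eval fun b : Fin 2 × Fin 2 => if b.1 = b.2 then (0 : K) else 1) h
  simp [permX, detX] at h1 h3
  exact h2 (by linear_combination h1 + h3)

end Perm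

/-! ## The determinant-class obstruction with a general target -/

section General
variable {K : Type u} [Field K]

/-- First = third index type of the stars `𝔖_2(1)`. [folklore] -/
abbrev Leaf2 := (Fin 2 × Fin 1) ⊕ (Fin 2 × Fin 1)

/-- **No degeneration `s ⊵ t` when `det S(y) = det Y · perm Y` and `det T(x) = (det X)²`**
(characteristic `≠ 2`; the `⟨2,2,2⟩` argument of `FarEdgeDescentSignTwistDet` with a general
target of the same format). [cite: BurgisserClausenShokrollahi1997, (15.19)] -/
theorem not_algDegeneratesTo_of_det_slice (h2 : (2 : K) ≠ 0)
    (s : Leaf2 → (Fin 2 × Fin 2) → Leaf2 → K)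
    (hs : ∀ y : Fin 2 × Fin 2 → (Rx K)[X], (Smat s y).det =
      (y (0, 0) * y (1, 1) - y (0, 1) * y (1, 0)) * (y (0, 0) * y (1, 1) + y (0, 1) * y (1, 0)))
    {ι' : Type*} [Fintype ι'] [DecidableEq ι'] (t : ι' → (Fin 2 × Fin 2) → ι' → K)
    (hcard : Fintype.card ι' = Fintype.card Leaf2) (ht : (Tmat t).det = detX K ^ 2) :
    ¬ AlgDegeneratesTo s t := by
  rintro ⟨h, A, B, C, hd⟩
  obtain ⟨q, D, hqD, hD0⟩ := slice_identity hd (Fintype.equivOfCardEq hcard)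
  rw [hs, ht] at *
  have hD : D.trailingCoeff = detX K ^ 2 := by
    have h0 : D.coeff 0 ≠ 0 := by rw [hD0]; exact pow_ne_zero _ (detX_ne_zero K)
    have hn : D.natTrailingDegree = 0 :=
      Nat.le_zero.mp (Polynomial.natTrailingDegree_le_of_ne_zero h0)
    rw [Polynomial.trailingCoeff, hn, hD0]
  have hX : ∀ n : ℕ, ((Polynomial.X : (Rx K)[X]) ^ n).trailingCoeff = 1 := fun n => by
    rw [Polynomial.trailingCoeff, Polynomial.natTrailingDegree_X_pow, Polynomial.coeff_X_pow,
      if_pos rfl]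
  have hq : (φK (Fin 2 × Fin 2) q).trailingCoeff =
      MvPolynomial.C (q.coeff (φK (Fin 2 × Fin 2) q).natTrailingDegree) := coeff_φK q _
  have htc := congrArg Polynomial.trailingCoeff hqD
  rw [Polynomial.trailingCoeff_mul, Polynomial.trailingCoeff_mul, Polynomial.trailingCoeff_mul, hX,
    one_mul, hD, hq, ← mul_assoc] at htc
  have hP : ((yv B (0, 0) * yv B (1, 1) - yv B (0, 1) * yv B (1, 0)).trailingCoeff).IsHomogeneous 2 := by
    rw [Polynomial.trailingCoeff, Polynomial.coeff_sub]
    exact (coeff_yv_mul_isHomogeneous B _ _ _).sub (coeff_yv_mul_isHomogeneous B _ _ _)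
  have hQ : ((yv B (0, 0) * yv B (1, 1) + yv B (0, 1) * yv B (1, 0)).trailingCoeff).IsHomogeneous 2 := by
    rw [Polynomial.trailingCoeff, Polynomial.coeff_add]
    exact (coeff_yv_mul_isHomogeneous B _ _ _).add (coeff_yv_mul_isHomogeneous B _ _ _)
  obtain ⟨⟨κ₁, hκ₁, h₁⟩, ⟨κ₂, hκ₂, h₂⟩⟩ := pair_eq_C_mul_detX hP hQ htc
  exact trailing_contradiction h2 (yv B) (coeff_yv_isHomogeneous B) hκ₁ hκ₂ h₁ h₂

/-- **No degeneration `s ⊵ t` when `det S(y) = (det Y)²` and `det T(x) = det X · perm X`**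
(characteristic `≠ 2`): trailing coefficients give `det X · perm X = c u²` with `u` a quadratic
form; `det X` is prime, so `u = κ det X` and `perm X = c κ² det X`, impossible.
[cite: BurgisserClausenShokrollahi1997, (15.19)] -/
theorem not_algDegeneratesTo_of_det_slice_sq (h2 : (2 : K) ≠ 0)
    (s : Leaf2 → (Fin 2 × Fin 2) → Leaf2 → K)
    (hs : ∀ y : Fin 2 × Fin 2 → (Rx K)[X], (Smat s y).det =
      (y (0, 0) * y (1, 1) - y (0, 1) * y (1, 0)) * (y (0, 0) * y (1, 1) - y (0, 1) * y (1, 0)))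
    {ι' : Type*} [Fintype ι'] [DecidableEq ι'] (t : ι' → (Fin 2 × Fin 2) → ι' → K)
    (hcard : Fintype.card ι' = Fintype.card Leaf2) (ht : (Tmat t).det = detX K * permX K) :
    ¬ AlgDegeneratesTo s t := by
  rintro ⟨h, A, B, C, hd⟩
  obtain ⟨q, D, hqD, hD0⟩ := slice_identity hd (Fintype.equivOfCardEq hcard)
  rw [hs, ht] at *
  have hD : D.trailingCoeff = detX K * permX K := by
    have h0 : D.coeff 0 ≠ 0 := by rw [hD0]; exact mul_ne_zero (detX_ne_zero K) (permX_ne_zero K)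
    have hn : D.natTrailingDegree = 0 :=
      Nat.le_zero.mp (Polynomial.natTrailingDegree_le_of_ne_zero h0)
    rw [Polynomial.trailingCoeff, hn, hD0]
  have hX : ∀ n : ℕ, ((Polynomial.X : (Rx K)[X]) ^ n).trailingCoeff = 1 := fun n => by
    rw [Polynomial.trailingCoeff, Polynomial.natTrailingDegree_X_pow, Polynomial.coeff_X_pow,
      if_pos rfl]
  set c : K := q.coeff (φK (Fin 2 × Fin 2) q).natTrailingDegree with hc
  have hq : (φK (Fin 2 × Fin 2) q).trailingCoeff = MvPolynomial.C c := coeff_φK q _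
  have htc := congrArg Polynomial.trailingCoeff hqD
  rw [Polynomial.trailingCoeff_mul, Polynomial.trailingCoeff_mul, Polynomial.trailingCoeff_mul, hX,
    one_mul, hD, hq] at htc
  set u := (yv B (0, 0) * yv B (1, 1) - yv B (0, 1) * yv B (1, 0)).trailingCoeff with hu
  -- htc : detX K * permX K = C c * (u * u)
  have hP : u.IsHomogeneous 2 := by
    rw [hu, Polynomial.trailingCoeff, Polynomial.coeff_sub]
    exact (coeff_yv_mul_isHomogeneous B _ _ _).sub (coeff_yv_mul_isHomogeneous B _ _ _)
  have hu0 : u ≠ 0 := by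
    intro h0
    rw [h0, mul_zero, mul_zero] at htc
    exact mul_ne_zero (detX_ne_zero K) (permX_ne_zero K) htc
  have hc0 : c ≠ 0 := by
    intro h0
    rw [h0, map_zero, zero_mul] at htc
    exact mul_ne_zero (detX_ne_zero K) (permX_ne_zero K) htc
  have hdvd : detX K ∣ u := by
    have h1 : detX K ∣ MvPolynomial.C c * (u * u) := ⟨permX K, htc.symm⟩
    rcases (detX_prime K).dvd_or_dvd h1 with h3 | h3
    · exact absurd (isUnit_of_dvd_unit h3 ((isUnit_iff_ne_zero.mpr hc0).map MvPolynomial.C))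
        (detX_prime K).not_unit
    · exact ((detX_prime K).dvd_or_dvd h3).elim id id
  obtain ⟨κ, hκ, hu'⟩ := eq_C_mul_detX_of_dvd hP hu0 hdvd
  have h3 : detX K * (permX K - MvPolynomial.C (c * κ ^ 2) * detX K) = 0 := by
    rw [mul_sub, htc, hu', map_mul, map_pow]
    ring
  exact permX_ne_C_mul_detX h2 _
    (sub_eq_zero.mp ((mul_eq_zero.mp h3).resolve_left (detX_ne_zero K)))

end General

/-! ## The slices of the three generic classes -/

section Slices
variable (K : Type u) [Field K]

/-- **The `y`-slice of `𝔖^ᵀ` is `Y ⊕ Yᵀ`.** [folklore] -/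
theorem Smat_twistedStar (y : Fin 2 × Fin 2 → (Rx K)[X]) :
    Smat (twistedStar K 2 1) y =
      Matrix.fromBlocks (leafMat fun i j => y (i, j)) 0 0 (leafMat fun i j => y (j, i)) := by
  rw [← permStar_prodComm]
  ext x x'
  rcases x with ⟨i, l⟩ | ⟨i, l⟩ <;> rcases x' with ⟨j, l'⟩ | ⟨j, l'⟩ <;>
  · obtain rfl : l = 0 := Subsingleton.elim _ _
    obtain rfl : l' = 0 := Subsingleton.elim _ _
    fin_cases i <;> fin_cases j <;>
      simp [Smat, leafMat, Fintype.sum_prod_type, Fin.sum_univ_two, matMulTensor]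

/-- **`det S(y) = (det Y)²`** for `𝔖^ᵀ`. [folklore] -/
theorem det_Smat_twistedStar (y : Fin 2 × Fin 2 → (Rx K)[X]) :
    (Smat (twistedStar K 2 1) y).det =
      (y (0, 0) * y (1, 1) - y (0, 1) * y (1, 0)) * (y (0, 0) * y (1, 1) - y (0, 1) * y (1, 0)) := by
  rw [Smat_twistedStar, Matrix.det_fromBlocks_zero₂₁, det_leafMat, det_leafMat]
  ring

/-- **The `x`-slice of `𝔖^ᵀ` is `X ⊕ Xᵀ`.** [folklore] -/
theorem Tmat_twistedStar : Tmat (twistedStar K 2 1) =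
    Matrix.fromBlocks (leafMat fun i j => (MvPolynomial.X (i, j) : Rx K)) 0 0
      (leafMat fun i j => (MvPolynomial.X (j, i) : Rx K)) := by
  rw [← permStar_prodComm]
  ext x x'
  rcases x with ⟨i, l⟩ | ⟨i, l⟩ <;> rcases x' with ⟨j, l'⟩ | ⟨j, l'⟩ <;>
  · obtain rfl : l = 0 := Subsingleton.elim _ _
    obtain rfl : l' = 0 := Subsingleton.elim _ _
    fin_cases i <;> fin_cases j <;>
      simp [Tmat, leafMat, Fintype.sum_prod_type, Fin.sum_univ_two, matMulTensor]

/-- **`det T(x) = (det X)²`** for `𝔖^ᵀ` — the determinant class of `⟨2,2,2⟩`. [folklore] -/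
theorem det_Tmat_twistedStar : (Tmat (twistedStar K 2 1)).det = detX K ^ 2 := by
  rw [Tmat_twistedStar, Matrix.det_fromBlocks_zero₂₁, det_leafMat, det_leafMat, detX]
  ring

/-- **The `x`-slice of `𝔖^♭` is `X ⊕ X^♭`.** [cite: CohnUmans2013, §3] -/
theorem Tmat_signStar : Tmat (signStar K) =
    Matrix.fromBlocks (leafMat fun i j => (MvPolynomial.X (i, j) : Rx K)) 0 0
      (leafMat fun i j => MvPolynomial.X (i, j) * MvPolynomial.C (sgnWeight K (i, j))) := by
  ext x x'
  rcases x with ⟨i, l⟩ | ⟨i, l⟩ <;> rcases x' with ⟨j, l'⟩ | ⟨j, l'⟩ <;>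
  · obtain rfl : l = 0 := Subsingleton.elim _ _
    obtain rfl : l' = 0 := Subsingleton.elim _ _
    fin_cases i <;> fin_cases j <;>
      simp [Tmat, leafMat, Fintype.sum_prod_type, Fin.sum_univ_two, sgnWeight, matMulTensor]

/-- **The `x`-slice of `𝔖^♭ᵀ` is `X ⊕ (X^♭)ᵀ`.** [cite: CohnUmans2013, §3] -/
theorem Tmat_signTStar : Tmat (signTStar K) =
    Matrix.fromBlocks (leafMat fun i j => (MvPolynomial.X (i, j) : Rx K)) 0 0
      (leafMat fun i j => MvPolynomial.X (j, i) * MvPolynomial.C (sgnWeight K (j, i))) := by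
  ext x x'
  rcases x with ⟨i, l⟩ | ⟨i, l⟩ <;> rcases x' with ⟨j, l'⟩ | ⟨j, l'⟩ <;>
  · obtain rfl : l = 0 := Subsingleton.elim _ _
    obtain rfl : l' = 0 := Subsingleton.elim _ _
    fin_cases i <;> fin_cases j <;>
      simp [Tmat, leafMat, Fintype.sum_prod_type, Fin.sum_univ_two, sgnWeight, matMulTensor]

/-- **`det T(x) = det X · perm X`** for `𝔖^♭`. [folklore] -/
theorem det_Tmat_signStar : (Tmat (signStar K)).det = detX K * permX K := by
  rw [Tmat_signStar, Matrix.det_fromBlocks_zero₂₁, det_leafMat, det_leafMat, detX, permX]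
  simp only [sgnWeight_one_zero, sgnWeight_of_ne K (b := (0, 0)) (by decide),
    sgnWeight_of_ne K (b := (0, 1)) (by decide), sgnWeight_of_ne K (b := (1, 1)) (by decide),
    map_one, map_neg, mul_one]
  ring

/-- **`det T(x) = det X · perm X`** for `𝔖^♭ᵀ`. [folklore] -/
theorem det_Tmat_signTStar : (Tmat (signTStar K)).det = detX K * permX K := by
  rw [Tmat_signTStar, Matrix.det_fromBlocks_zero₂₁, det_leafMat, det_leafMat, detX, permX]
  simp only [sgnWeight_one_zero, sgnWeight_of_ne K (b := (0, 0)) (by decide),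
    sgnWeight_of_ne K (b := (0, 1)) (by decide), sgnWeight_of_ne K (b := (1, 1)) (by decide),
    map_one, map_neg, mul_one]
  ring

end Slices

/-! ## The three generic classes among each other -/

section Classes
variable (K : Type u) [Field K]

/-- **`𝔖^♭ ⋭ 𝔖^ᵀ`** (single copy, characteristic `≠ 2`). [cite: BurgisserClausenShokrollahi1997, (15.19), sec. 20.2] -/
theorem signStar_not_algDegeneratesTo_twistedStar (h2 : (2 : K) ≠ 0) :
    ¬ AlgDegeneratesTo (signStar K) (twistedStar K 2 1) :=
  not_algDegeneratesTo_of_det_slice h2 _ (det_Smat_signStar K) _ rfl (det_Tmat_twistedStar K)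

/-- **`𝔖^♭ᵀ ⋭ 𝔖^ᵀ`** (single copy, characteristic `≠ 2`). [cite: BurgisserClausenShokrollahi1997, (15.19), sec. 20.2] -/
theorem signTStar_not_algDegeneratesTo_twistedStar (h2 : (2 : K) ≠ 0) :
    ¬ AlgDegeneratesTo (signTStar K) (twistedStar K 2 1) :=
  not_algDegeneratesTo_of_det_slice h2 _ (det_Smat_signTStar K) _ rfl (det_Tmat_twistedStar K)

/-- **`𝔖^ᵀ ⋭ 𝔖^♭`** (single copy, characteristic `≠ 2`). [cite: BurgisserClausenShokrollahi1997, (15.19), sec. 20.2] -/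
theorem twistedStar_not_algDegeneratesTo_signStar (h2 : (2 : K) ≠ 0) :
    ¬ AlgDegeneratesTo (twistedStar K 2 1) (signStar K) :=
  not_algDegeneratesTo_of_det_slice_sq h2 _ (det_Smat_twistedStar K) _ rfl (det_Tmat_signStar K)

/-- **`𝔖^ᵀ ⋭ 𝔖^♭ᵀ`** (single copy, characteristic `≠ 2`). [cite: BurgisserClausenShokrollahi1997, (15.19), sec. 20.2] -/
theorem twistedStar_not_algDegeneratesTo_signTStar (h2 : (2 : K) ≠ 0) :
    ¬ AlgDegeneratesTo (twistedStar K 2 1) (signTStar K) :=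
  not_algDegeneratesTo_of_det_slice_sq h2 _ (det_Smat_twistedStar K) _ rfl (det_Tmat_signTStar K)

/-- **The determinant classes sort the generic twists**: `𝔖^ᵀ` (class `det²`, shared with
`⟨2,2,2⟩`) is degeneration-incomparable with `𝔖^♭` and with `𝔖^♭ᵀ` (class `det · perm`), single
copy, characteristic `≠ 2`. [cite: BurgisserClausenShokrollahi1997, (15.19), sec. 20.2; CohnUmans2013, §3] -/
theorem generic_twists_detClass_incomparable (h2 : (2 : K) ≠ 0) :
    (¬ AlgDegeneratesTo (signStar K) (twistedStar K 2 1) ∧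
      ¬ AlgDegeneratesTo (twistedStar K 2 1) (signStar K)) ∧
    (¬ AlgDegeneratesTo (signTStar K) (twistedStar K 2 1) ∧
      ¬ AlgDegeneratesTo (twistedStar K 2 1) (signTStar K)) :=
  ⟨⟨signStar_not_algDegeneratesTo_twistedStar K h2, twistedStar_not_algDegeneratesTo_signStar K h2⟩,
    ⟨signTStar_not_algDegeneratesTo_twistedStar K h2, twistedStar_not_algDegeneratesTo_signTStar K h2⟩⟩

end Classes

end Summit.MatrixMultiplication.MatrixMultiplication.Theorems.FarEdgeDescentSignTwistDet

end
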